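import Summits.QuantumFields.BalabanUV.Beta.WardLocusInductionBorder
import Summits.QuantumFields.BalabanUV.Beta.RelInvSymBorderedHessianStep
import Summits.QuantumFields.BalabanUV.Beta.SymmetrisedStepJets
import Summits.QuantumFields.BalabanUV.Beta.SecondOrderUnits

/-!
# `BalabanUV.Beta.SymShiftedSpread` — binder row D1, RULING R-D1-g28-1: THE SHIFTED STRAIGHT SPREAD `bhKStepSh Dsh j := bhKStep j + stepScale j • Dsh`
# OF THE (0.4) LITERAL, ITS STRUCTURE (`bhKStep (j+1) = ffK + stepScale • border bhK`), THE `mm`-READ OF THE SYMMETRISED STEP RESOLVENT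
# (`mmRead (Gsym j) = E2 (j+1)`), AND THE STEP-HESSIAN DICTIONARY (hM′) FROM THE ONE BORDER LETTER (V-d)

HONEST FRAMING (cell charter, verbatim): «discharging BetaPertH makes Balaban's UV stability UNCONDITIONAL — a real constructive-QFT result; it is
NOT the continuum limit and NOT the Clay problem.»  HONEST DEPENDENCY: continuum YM on T⁴ ⇐ BetaPertH ∧ nine spine estimates (0/9 proved);
BetaPertH ⇐ (D1) ∧ (D4) ∧ CAP+tail; G-an2-4 gates asym, D1 and NE2/3/4.
DERIVED cell leaf (β sub-cell, BINDER-OWNERS row D1 OWNER `b2b-balaban-beta-an2`, gen 28).  WHY: X-an2-55 (an1-g36's exact line): the first-order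
border table `tabs.V` of the symmetrised literal obeys, pointwise in the varied site, the ROOTED-shape Ward law of `WardLocusStencils.conjV_bhKAt_diagK_legInd`
with root contact at the CENTRE and against the symmetrised-rooted bordered Hessian `bhKSym = bhK + Dsh` (`Dsh` `symEc`-null); RULING R-D1-g28-1 makes
`𝕄̃ j := bhKStep d Lc j + stepScale d Lc j • Dsh` the spread of record of the literal's letters.  This file is the spread-side bookkeeping of the
(Sd) route (`WardLocusInductionBorder.hSd_all_border` at `(K, M, E, Vb) := (Gsym, 𝕄̃, symEc, tabs.V)`): the data def `bhKStepSh`, its spread, the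
straight step's structure, the `mm`-read of `Gsym`, and the dictionary (hM′) as a THEOREM from the displayed border letter (V-d) — for ANY shift `D`,
ANY border table `Vb`, ANY root `ρ` (nothing of an1's values is used).  No statement of Bałaban's papers, no `[cite:]`, no `Prop` fact; ONE data `def`
(`bhKStepSh`, [our object — a CANDIDATE asserting nothing]).  Discharges NO binder; root-level classes 0∕5; NOT D1, NOT `BetaPertH`, NOT continuum, NOT Clay.
WHAT ([folklore]): §1 `bhKStepSh`, `bhKStepSh_zero`, `bhKStepSh_succ`, `spr_bhKStepSh`; §2 `bhKStep_succ_eq_ffK_add_smul`, `ffK_bhKStep_succ`; §3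
`coDressKSymAt_inr_inr`, `mmRead_coDressKSymAt_KInvStep`, `mmRead_Gsym`; §4 `conjV_add_diagK`, **`conjV_bhKStepSh_succ_diagK_legInd_of_borderLaw`** (hM′).
Provenance: β sub-cell, unit beta-an2 gen 28, 2026-08-21 (v1); over `BorderedHessianStepStraight` (an2 gen 15), `WardLocusInduction` (the comb twins
`coDressKBmAt_inr_inr` ∕ `mmRead_coDressKBmAt_KInvStep` ∕ `conjV_bhKStepAt_succ_diagK_legInd_step`), `SymmetrisedStepJets` BY NAME; no existing file touched.
-/

noncomputable section

open Finset
open scoped BigOperators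
open Literature.MathematicalPhysics.QuantumFieldTheory
open Literature.MathematicalPhysics.QuantumFieldTheory.Balaban1983to89
open Literature.MathematicalPhysics.QuantumFieldTheory.Balaban1983to89.Beta
open ExpKernelCalculus (MKer Decays comp)
open OneStepResolventKernel (Fib KInv)
open OneStepKernelFamily (KInvStep)
open KernelWard (divV)
open AffineAveraging (box toSite)
open AveragingContoursRooted (ctr ctrOff ctrOff_mem_box)
open BalabanStepJetsSucc (mmRead mmRead_inl_inl mmRead_inr_left mmRead_inr_right wVH E2)
open Summit.QuantumFields.BalabanUV.Beta.TameKernelCalculus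
open Summit.QuantumFields.BalabanUV.Beta.ChartConjugation (conjV)
open Summit.QuantumFields.BalabanUV.Beta.AxialDressingRooted (one_le_of_neZero tsum_point')
open Summit.QuantumFields.BalabanUV.Beta.BorderedHessian (bhK bhK_inr_inr bhKStep bhKStep_zero bhKStep_succ_inl_inl bhKStep_succ_inl_inr
  bhKStep_succ_inr_inl bhKStep_succ_inr_inr spr_bhKStep stepScale stepScale_ne_zero diagK conjV_diagK_apply)
open Summit.QuantumFields.BalabanUV.Beta.AveragingWardRootedStencils (legInd)
open Summit.QuantumFields.BalabanUV.Beta.WardLocusStencils (ffK ffK_inl_inl ffK_inl_inr ffK_inr_inl ffK_inr_inr)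
open Summit.QuantumFields.BalabanUV.Beta.SymmetrisedDressingKernel (piKSymBm piKSymBm_inl_inr piKSymBm_inr_inr coDressKSymAt coDressKSymAt_eq
  comp_piKSymBm_inr)
open Summit.QuantumFields.BalabanUV.Beta.SymmetrisedStepJets (Gsym Gsym_apply decays_Gsym)
open Summit.QuantumFields.BalabanUV.Beta.SecondOrderUnits (KInvStep_mm_eq_KInv_mm)

namespace Summit.QuantumFields.BalabanUV.Beta.SymShiftedSpread

variable {d : ℕ}

/-! ## §1 The shifted straight spread -/

section Def

variable (d) (Lc : ℕ) [NeZero Lc]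

/-- [our object — a CANDIDATE asserting nothing] **THE SHIFTED STRAIGHT SPREAD** of RULING R-D1-g28-1: `bhKStepSh D j := bhKStep d Lc j + stepScale d Lc j • D`
— at `j = 0` the bordered Hessian `bhK Lc + D` (for the literal: the symmetrised-rooted `bhKSym`), at `j + 1` the straight step candidate with its
border shifted by `stepScale (j+1) • D`. -/
def bhKStepSh (D : MKer (d + 1) (Fib d)) : ℕ → MKer (d + 1) (Fib d) := fun j => bhKStep d Lc j + stepScale d Lc j • D

variable {d Lc}

/-- [folklore] `bhKStepSh` unfolded. -/
theorem bhKStepSh_apply (D : MKer (d + 1) (Fib d)) (j : ℕ) : bhKStepSh d Lc D j = bhKStep d Lc j + stepScale d Lc j • D := rfl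

/-- [folklore] Level `0`: `bhKStepSh D 0 = bhK Lc + D`. -/
theorem bhKStepSh_zero (D : MKer (d + 1) (Fib d)) : bhKStepSh d Lc D 0 = bhK Lc + D := by
  rw [bhKStepSh_apply, bhKStep_zero]
  simp [stepScale]

/-- [folklore] **THE SHIFTED SPREAD IS SPREAD** at every level, for a spread shift. -/
theorem spr_bhKStepSh {D : MKer (d + 1) (Fib d)} (hD : Spr D) : ∀ j : ℕ, Spr (bhKStepSh d Lc D j) := by
  intro j
  obtain ⟨C, δ, hδ, h⟩ := spr_bhKStep (d := d) (Lc := Lc) j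
  obtain ⟨C', δ', hδ', h'⟩ := hD
  refine ⟨|C| + |stepScale d Lc j| * |C'|, min δ δ', lt_min hδ hδ', fun x y a b => ?_⟩
  have h1 := decays_of_le h (min_le_left δ δ') x y a b
  have h2 := decays_of_le h' (min_le_right δ δ') x y a b
  rw [bhKStepSh_apply]
  calc |(bhKStep d Lc j + stepScale d Lc j • D) x y a b| = |bhKStep d Lc j x y a b + stepScale d Lc j * D x y a b| := rfl
    _ ≤ |bhKStep d Lc j x y a b| + |stepScale d Lc j| * |D x y a b| := by rw [← abs_mul]; exact abs_add_le _ _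
    _ ≤ |C| * Real.exp (-min δ δ' * B12Sec2to5.l1 (x - y)) + |stepScale d Lc j| * (|C'| * Real.exp (-min δ δ' * B12Sec2to5.l1 (x - y))) :=
        add_le_add h1 (mul_le_mul_of_nonneg_left h2 (abs_nonneg _))
    _ = _ := by ring

end Def

/-! ## §2 The structure of the straight step candidate: field window plus scaled straight border -/

section Structure

variable {Lc : ℕ} [NeZero Lc]

/-- [folklore] **`bhKStep (j+1) = ffK (bhKStep (j+1)) + stepScale (j+1) • (bhK − ffK bhK)`**: the step candidate is its field–field window plus
`stepScale (j+1)` times the BORDER of the undressed straight bordered Hessian (entrywise from `BorderedHessianStepStraight` §1; `bhK_inr_inr = 0`). -/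
theorem bhKStep_succ_eq_ffK_add_smul (j : ℕ) :
    bhKStep d Lc (j + 1) = ffK (bhKStep d Lc (j + 1)) + stepScale d Lc (j + 1) • (bhK Lc - ffK (bhK (d := d) Lc)) := by
  funext x z a b
  simp only [Pi.add_apply, Pi.smul_apply, Pi.sub_apply, smul_eq_mul]
  rcases a with κ | κ <;> rcases b with l | l
  · rw [ffK_inl_inl, ffK_inl_inl]; ring
  · rw [ffK_inl_inr, ffK_inl_inr, bhKStep_succ_inl_inr]; ring
  · rw [ffK_inr_inl, ffK_inr_inl, bhKStep_succ_inr_inl]; ring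
  · rw [ffK_inr_inr, ffK_inr_inr, bhKStep_succ_inr_inr, bhK_inr_inr]; ring

/-- [folklore] **THE FIELD WINDOW OF THE STRAIGHT STEP CANDIDATE IS THE WEIGHTED VALUE HESSIAN** `wVH (j+1) • E2 (j+1)` (twin of
`WardLocusCubic.ffK_bhKStepAt_succ`; the straight and the rooted candidates share the field block). -/
theorem ffK_bhKStep_succ (j : ℕ) : ffK (bhKStep d Lc (j + 1)) = wVH d Lc (j + 1) • E2 d Lc (j + 1) := by
  funext x z a b
  simp only [Pi.smul_apply, smul_eq_mul]
  rcases a with α | μ <;> rcases b with β | ν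
  · rw [ffK_inl_inl, bhKStep_succ_inl_inl]
  · rw [ffK_inl_inr]; unfold BalabanStepJetsSucc.E2; rw [mmRead_inr_right, mul_zero]
  · rw [ffK_inr_inl]; unfold BalabanStepJetsSucc.E2; rw [mmRead_inr_left, mul_zero]
  · rw [ffK_inr_inr]; unfold BalabanStepJetsSucc.E2; rw [mmRead_inr_left, mul_zero]

end Structure

/-! ## §3 The `mm`-read of the symmetrised co-dressed step resolvent -/

section MMRead

/-- [folklore] **THE SYMMETRISED CO-DRESSING DOES NOT TOUCH THE MULTIPLIER BLOCK**: `(Π̂ᵀ_sym ∘ K ∘ Π̂_sym)((x, inr m), (z, inr m′)) = K((x, inr m), (z, inr m′))`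
(`piKSymBm` is the identity on multiplier legs and has no field–multiplier entries; twin of `WardLocusInduction.coDressKBmAt_inr_inr`). -/
theorem coDressKSymAt_inr_inr (ρ : Fin (d + 1) → ℤ) (N : ℕ) (K : MKer (d + 1) (Fib d)) (x z : Fin (d + 1) → ℤ) (m m' : Fin (d + 1)) :
    coDressKSymAt ρ N K x z (Sum.inr m) (Sum.inr m') = K x z (Sum.inr m) (Sum.inr m') := by
  rw [coDressKSymAt_eq, comp_piKSymBm_inr]
  unfold ExpKernelCalculus.comp
  have h : ∀ u, ∑ g : Fib d, trK (piKSymBm ρ N) x u (Sum.inr m) g * K u z g (Sum.inr m') =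
      if u = x then K u z (Sum.inr m) (Sum.inr m') else 0 := by
    intro u
    rw [Fintype.sum_sum_type]
    simp only [trK_apply, piKSymBm_inl_inr, zero_mul, Finset.sum_const_zero, zero_add, piKSymBm_inr_inr]
    by_cases hu : u = x
    · rw [if_pos hu]
      rw [Finset.sum_eq_single m (fun m'' _ hm => by rw [if_neg (fun h => hm h.2), zero_mul]) (fun h => absurd (Finset.mem_univ m) h)]
      rw [if_pos ⟨hu, rfl⟩, one_mul]
    · rw [if_neg hu]
      exact Finset.sum_eq_zero fun m'' _ => by rw [if_neg (fun h => hu h.1), zero_mul]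
  simp_rw [h]
  exact tsum_point' x fun u => K u z (Sum.inr m) (Sum.inr m')

variable {Lc : ℕ} [NeZero Lc]

/-- [folklore] **THE `mm`-READ OF THE SYMMETRISED STEP PROPAGATOR IS THE NEXT VALUE HESSIAN**: `mmRead Lc (coDressKSymAt ρ Lc (KInvStep Lc j)) = E2 (j+1)`
(twin of `WardLocusInduction.mmRead_coDressKBmAt_KInvStep`: `SecondOrderUnits.KInvStep_mm_eq_KInv_mm` + `coDressKSymAt_inr_inr`). -/
theorem mmRead_coDressKSymAt_KInvStep (ρ : Fin (d + 1) → ℤ) (j : ℕ) :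
    mmRead Lc (coDressKSymAt ρ Lc (KInvStep (d := d) Lc j)) = E2 d Lc (j + 1) := by
  funext x z a b
  rcases a with α | μ <;> rcases b with β | ν
  · rw [mmRead_inl_inl, coDressKSymAt_inr_inr, KInvStep_mm_eq_KInv_mm]
    unfold BalabanStepJetsSucc.E2
    rw [mmRead_inl_inl]
  · unfold BalabanStepJetsSucc.E2; rw [mmRead_inr_right, mmRead_inr_right]
  · unfold BalabanStepJetsSucc.E2; rw [mmRead_inr_left, mmRead_inr_left]
  · unfold BalabanStepJetsSucc.E2; rw [mmRead_inr_left, mmRead_inr_left]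

/-- [folklore] On the literal's name: `mmRead Lc (Gsym Lc j) = E2 (j+1)`. -/
theorem mmRead_Gsym (j : ℕ) : mmRead Lc (Gsym (d := d) Lc j) = E2 d Lc (j + 1) := by
  rw [Gsym_apply]
  exact mmRead_coDressKSymAt_KInvStep _ j

end MMRead

/-! ## §4 The step-Hessian dictionary (hM′) of the shifted spread from the border letter (V-d) -/

section Dictionary

variable {Lc : ℕ} [NeZero Lc]

/-- [folklore] The diagonal contact is additive in the kernel. -/
theorem conjV_add_diagK (M M' : MKer (d + 1) (Fib d)) (g : (Fin (d + 1) → ℤ) → Fib d → ℝ) :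
    conjV (M + M') (diagK g) = conjV M (diagK g) + conjV M' (diagK g) := by
  funext x z a b
  simp only [conjV_diagK_apply, Pi.add_apply]
  ring

/-- [folklore] The diagonal contact is subtractive in the kernel. -/
theorem conjV_sub_diagK (M M' : MKer (d + 1) (Fib d)) (g : (Fin (d + 1) → ℤ) → Fib d → ℝ) :
    conjV (M - M') (diagK g) = conjV M (diagK g) - conjV M' (diagK g) := by
  funext x z a b
  simp only [conjV_diagK_apply, Pi.sub_apply]
  ring

/-- [folklore] **THE STEP-HESSIAN DICTIONARY (hM′) OF THE SHIFTED SPREAD FROM THE BORDER LETTER (V-d)** (any shift `D`, border table `Vb`, root `ρ`):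
if `conjV (bhK Lc + D) (diagK (legInd ρ u)) = conjV (ffK (bhK Lc)) (diagK (legInd ρ u)) − Lc^{d+1} • divV Vb u` (V-d) then
`conjV (bhKStepSh D (j+1)) (diagK (legInd ρ u)) = wVH (j+1) • conjV (mmRead Lc (Gsym Lc j)) (diagK (legInd ρ u)) − (stepScale (j+1)·Lc^{d+1}) • divV Vb u`
— the hypothesis (hM′) of `WardLocusInductionBorder.hSd_step_border` at `(K, M′, Vb) := (Gsym Lc j, bhKStepSh D (j+1), Vb)`, `w := wVH (j+1)`,
`P := stepScale (j+1)·Lc^{d+1}` (twin of the comb's `WardLocusInduction.conjV_bhKStepAt_succ_diagK_legInd_step`). -/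
theorem conjV_bhKStepSh_succ_diagK_legInd_of_borderLaw {D : MKer (d + 1) (Fib d)} {Vb : Fin (d + 1) → (Fin (d + 1) → ℤ) → MKer (d + 1) (Fib d)}
    {ρ : Fin (d + 1) → ℤ}
    (hVd : ∀ u : Fin (d + 1) → ℤ, conjV (bhK Lc + D) (diagK (legInd ρ u)) =
      conjV (ffK (bhK (d := d) Lc)) (diagK (legInd ρ u)) - ((Lc : ℝ) ^ (d + 1)) • divV Vb u)
    (j : ℕ) (u : Fin (d + 1) → ℤ) :
    conjV (bhKStepSh d Lc D (j + 1)) (diagK (legInd ρ u)) =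
      wVH d Lc (j + 1) • conjV (mmRead Lc (Gsym (d := d) Lc j)) (diagK (legInd ρ u)) -
        (stepScale d Lc (j + 1) * (Lc : ℝ) ^ (d + 1)) • divV Vb u := by
  have e : bhKStepSh d Lc D (j + 1) = ffK (bhKStep d Lc (j + 1)) + stepScale d Lc (j + 1) • ((bhK Lc + D) - ffK (bhK (d := d) Lc)) := by
    have h := bhKStep_succ_eq_ffK_add_smul (d := d) (Lc := Lc) j
    rw [bhKStepSh_apply]
    conv_lhs => rw [h]
    funext x z a b
    simp only [Pi.add_apply, Pi.smul_apply, Pi.sub_apply, smul_eq_mul]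
    ring
  rw [e, conjV_add_diagK, WardLocusCubic.conjV_smul_diagK, conjV_sub_diagK, hVd u, ffK_bhKStep_succ, WardLocusCubic.conjV_smul_diagK, mmRead_Gsym,
    mul_smul]
  funext x z a b
  simp only [Pi.add_apply, Pi.sub_apply, Pi.smul_apply, smul_eq_mul]
  ring

/-- [folklore] **LEVEL `0` OF THE SHIFTED SPREAD UNDER (V-d)**: `conjV (bhKStepSh D 0) (diagK (legInd ρ u)) = conjV (ffK (bhK Lc)) (diagK (legInd ρ u)) − Lc^{d+1} • divV Vb u`. -/
theorem conjV_bhKStepSh_zero_diagK_legInd_of_borderLaw {D : MKer (d + 1) (Fib d)} {Vb : Fin (d + 1) → (Fin (d + 1) → ℤ) → MKer (d + 1) (Fib d)}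
    {ρ : Fin (d + 1) → ℤ}
    (hVd : ∀ u : Fin (d + 1) → ℤ, conjV (bhK Lc + D) (diagK (legInd ρ u)) =
      conjV (ffK (bhK (d := d) Lc)) (diagK (legInd ρ u)) - ((Lc : ℝ) ^ (d + 1)) • divV Vb u)
    (u : Fin (d + 1) → ℤ) :
    conjV (bhKStepSh d Lc D 0) (diagK (legInd ρ u)) = conjV (ffK (bhK (d := d) Lc)) (diagK (legInd ρ u)) - ((Lc : ℝ) ^ (d + 1)) • divV Vb u := by
  rw [bhKStepSh_zero]
  exact hVd u

end Dictionary

end Summit.QuantumFields.BalabanUV.Beta.SymShiftedSpread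

end
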